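import Mathlib
import Summits.ResolutionOfSingularities.ResolutionOfSingularities.Theorems.HomologicalConductorSurfaceTerminationCubicConeExit
import HarnessLib

/-!
# Kill test `SurfaceTermination` (stmt-ResolutionOfSingularities-16488), (R-QH) «CUBIC CONE EXIT», part 3:
# NON-VACUITY WITNESS — the cubic cone IS prime, and the weight valuation of its fraction field EXISTS

Route `ResolutionOfSingularities/HomologicalConductor` (cell `res-hironaka`, chain W4.4), kill test `SurfaceTermination`
(stmt-16488), residue stub `stub_initialPairOfConstantGenus`; res-L0-w44-plan-1 CHAIN v21 (ρ35e) / v23 «GO … + the witness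
valuation (non-vacuity)», res-D-pv-045 g7. OURS; AI-written, weaker than expert review; nothing here is a statement of the
manuscript under review (Hironaka 2017) and no statement of it is used; no theorem here concludes the kill test or the crux.

Parts 1–2 (`…CubicConeCa`, `…CubicConeExit`) prove the (E) initial pair and the exit of the `ca`-tower for every datum
`(k, K, x, y, z, O)` with `hker` (the kernel of `Xᵢ ↦ x, y, z` is `(f)`, `f = X₀²X₁ + X₁²X₂ + X₂²X₀`), `hk`, `hx`
(`O ∋ k`, `O.valuation x < 1`) and the WEIGHT property `hW`. This file shows the bundle is INHABITED over EVERY field `k`: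
* §1 `prime_f` — `f` is PRIME in `k[X₀,X₁,X₂]` (Eisenstein at `(X₂)` for `f = X₁·X₀² + X₂²·X₀ + X₁²X₂ ∈ k[X₁,X₂][X₀]`,
  Mathlib's `Polynomial.IsEisensteinAt.irreducible` through `MvPolynomial.finSuccEquiv`; primitivity from `MvPolynomial.X_prime`),
  hence `A := k[X] ⧸ (f)` is a domain (`isDomain_quotient_f`);
* §2 for a field `K` and an INJECTIVE `k`-algebra map `ι : A → K` (`x, y, z` := the images of `X₀, X₁, X₂`): `hker`
  (`ker_aeval_eq_span_f`); the graded embedding `θ : k[X] → K[T]`, `Xᵢ ↦ C(xᵢ)·T`, sends a form `F` of degree `d` to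
  `C(F(x,y,z))·Tᵈ` (`aeval_C_mul_X_of_isHomogeneous`), kills `f`, and the induced `θ̄ : A → K[T]` is INJECTIVE
  (`injective_thetaBar`: read the coefficient of `Tᵈ` = the value of the degree-`d` component, then `hker`);
* §3 with `K = Frac A` (`IsFractionRing A K`): extend `θ̄` to `φ : K → K(T)` and pull back the `T`-adic valuation
  (`Polynomial.idealX`): `O := (v_T ∘ φ).valuationSubring` satisfies `hk`, `hx`, `hW` (`witness_hk`, `witness_hx`, `witness_hW`),
  and `K` is the fraction field of the range `k[x,y,z]` (`isFractionRing_range`);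
* §4 **`exists_cubicCone_weightValuation_witness`** — for every field `k` there are `K, x, y, z, O` with
  `hker ∧ hk ∧ hx ∧ hW ∧ IsFractionRing ↥A K`, and **`initialPair_cubicCone_inhabited`** — part 2's (E)-pair theorem
  applied to them (the bundle of hypotheses of `initialPair_cubicCone` is non-vacuous).
References (mechanism only): none beyond Mathlib (Eisenstein's criterion; adic valuations of `K[T]`).
-/

noncomputable section

-- single-problem summit: the doubled namespace component `ResolutionOfSingularities` is forced
set_option linter.dupNamespace false

namespace Summit.ResolutionOfSingularities.ResolutionOfSingularities.Theorems.SurfaceTermination.CubicCone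

open MvPolynomial

/-! ## §1 `f = X₀²X₁ + X₁²X₂ + X₂²X₀` is prime -/

section Prime

variable (k : Type) [Field k]

/-- `f` as a quadratic in `X₀` over `k[X₁, X₂]`: `finSuccEquiv f = C(X₀')·T² + C(X₁'²)·T + C(X₀'²X₁')`
(`X₀' , X₁'` the images of `X₁, X₂`). [folklore] -/
theorem finSuccEquiv_f :
    MvPolynomial.finSuccEquiv k 2 (X 0 ^ 2 * X 1 + X 1 ^ 2 * X 2 + X 2 ^ 2 * X 0) =
      Polynomial.C (X 0) * Polynomial.X ^ 2 + Polynomial.C (X 1 ^ 2) * Polynomial.X +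
        Polynomial.C (X 0 ^ 2 * X 1) := by
  have h1 : MvPolynomial.finSuccEquiv k 2 (X 1) = Polynomial.C (X 0) := by
    rw [show (X 1 : MvPolynomial (Fin 3) k) = X (Fin.succ 0) from rfl, finSuccEquiv_X_succ]
  have h2 : MvPolynomial.finSuccEquiv k 2 (X 2) = Polynomial.C (X 1) := by
    rw [show (X 2 : MvPolynomial (Fin 3) k) = X (Fin.succ 1) from rfl, finSuccEquiv_X_succ]
  simp only [map_add, map_mul, map_pow, finSuccEquiv_X_zero, h1, h2, map_pow, map_mul]
  ring

/-- The quadratic `C(X₀)·T² + C(X₁²)·T + C(X₀²X₁) ∈ k[X₀,X₁][T]` is irreducible: EISENSTEIN at the prime `(X₁)` (leading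
coefficient `X₀ ∉ (X₁)`, `X₁², X₀²X₁ ∈ (X₁)`, `X₀²X₁ ∉ (X₁)²`), primitive since its coefficients `X₀`, `X₁²` are coprime.
[folklore] -/
theorem irreducible_fPoly :
    Irreducible (Polynomial.C (X 0 : MvPolynomial (Fin 2) k) * Polynomial.X ^ 2 + Polynomial.C (X 1 ^ 2) * Polynomial.X +
      Polynomial.C (X 0 ^ 2 * X 1)) := by
  have hX0 : (X 0 : MvPolynomial (Fin 2) k) ≠ 0 := X_ne_zero 0
  have hX1 : (X 1 : MvPolynomial (Fin 2) k) ≠ 0 := X_ne_zero 1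
  have hp0 : Prime (X 0 : MvPolynomial (Fin 2) k) := X_prime
  have hp1 : Prime (X 1 : MvPolynomial (Fin 2) k) := X_prime
  have h01 : ¬ ((X 1 : MvPolynomial (Fin 2) k) ∣ X 0) := fun h => by
    have := (X_dvd_X (R := k)).mp h; exact absurd this (by decide)
  have h10 : ¬ ((X 0 : MvPolynomial (Fin 2) k) ∣ X 1) := fun h => by
    have := (X_dvd_X (R := k)).mp h; exact absurd this (by decide)
  have hdeg := Polynomial.natDegree_quadratic (b := (X 1 : MvPolynomial (Fin 2) k) ^ 2) (c := X 0 ^ 2 * X 1) hX0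
  have hlead := Polynomial.leadingCoeff_quadratic (b := (X 1 : MvPolynomial (Fin 2) k) ^ 2) (c := X 0 ^ 2 * X 1) hX0
  have hc0 : (Polynomial.C (X 0 : MvPolynomial (Fin 2) k) * Polynomial.X ^ 2 + Polynomial.C (X 1 ^ 2) * Polynomial.X +
      Polynomial.C (X 0 ^ 2 * X 1)).coeff 0 = X 0 ^ 2 * X 1 := by
    simp only [Polynomial.coeff_add, Polynomial.coeff_C_mul, Polynomial.coeff_X_pow, Polynomial.coeff_X,
      Polynomial.coeff_C]
    norm_num
  have hc1 : (Polynomial.C (X 0 : MvPolynomial (Fin 2) k) * Polynomial.X ^ 2 + Polynomial.C (X 1 ^ 2) * Polynomial.X +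
      Polynomial.C (X 0 ^ 2 * X 1)).coeff 1 = X 1 ^ 2 := by
    simp only [Polynomial.coeff_add, Polynomial.coeff_C_mul, Polynomial.coeff_X_pow, Polynomial.coeff_X,
      Polynomial.coeff_C]
    norm_num
  have hc2 : (Polynomial.C (X 0 : MvPolynomial (Fin 2) k) * Polynomial.X ^ 2 + Polynomial.C (X 1 ^ 2) * Polynomial.X +
      Polynomial.C (X 0 ^ 2 * X 1)).coeff 2 = X 0 := by
    simp only [Polynomial.coeff_add, Polynomial.coeff_C_mul, Polynomial.coeff_X_pow, Polynomial.coeff_X,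
      Polynomial.coeff_C]
    norm_num
  have h𝓟 : (Ideal.span {(X 1 : MvPolynomial (Fin 2) k)}).IsPrime := (Ideal.span_singleton_prime hX1).mpr hp1
  refine Polynomial.IsEisensteinAt.irreducible (𝓟 := Ideal.span {X 1}) ⟨?_, ?_, ?_⟩ h𝓟 ?_ (by rw [hdeg]; norm_num)
  · rw [hlead, Ideal.mem_span_singleton]; exact h01
  · intro n hn
    rw [hdeg] at hn
    interval_cases n
    · rw [hc0]; exact Ideal.mem_span_singleton.mpr (dvd_mul_left _ _)
    · rw [hc1]; exact Ideal.mem_span_singleton.mpr (dvd_pow_self _ two_ne_zero)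
  · rw [Ideal.span_singleton_pow, Ideal.mem_span_singleton, hc0, pow_two]
    intro h
    have h' : (X 1 : MvPolynomial (Fin 2) k) ∣ X 0 ^ 2 := (mul_dvd_mul_iff_right hX1).mp (by simpa [mul_comm] using h)
    exact h01 (hp1.dvd_of_dvd_pow h')
  · intro r hr
    rw [Polynomial.C_dvd_iff_dvd_coeff] at hr
    have h2 : r ∣ X 0 := by rw [← hc2]; exact hr 2
    have h1' : r ∣ X 1 ^ 2 := by rw [← hc1]; exact hr 1
    obtain ⟨s, hs⟩ := h2
    rcases hp0.irreducible.isUnit_or_isUnit hs with hu | hu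
    · exact hu
    · exfalso
      have hX0r : (X 0 : MvPolynomial (Fin 2) k) ∣ r := ⟨↑hu.unit⁻¹, by rw [hs, mul_assoc, IsUnit.mul_val_inv, mul_one]⟩
      exact h10 (hp0.dvd_of_dvd_pow (hX0r.trans h1'))

/-- **`f = X₀²X₁ + X₁²X₂ + X₂²X₀` is prime in `k[X₀,X₁,X₂]`**, every field `k`. [folklore] -/
theorem prime_f : Prime (X 0 ^ 2 * X 1 + X 1 ^ 2 * X 2 + X 2 ^ 2 * X 0 : MvPolynomial (Fin 3) k) := by
  have hirr : Irreducible (X 0 ^ 2 * X 1 + X 1 ^ 2 * X 2 + X 2 ^ 2 * X 0 : MvPolynomial (Fin 3) k) := by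
    have h := irreducible_fPoly k
    rw [← finSuccEquiv_f] at h
    exact (MulEquiv.irreducible_iff (MvPolynomial.finSuccEquiv k 2)).mp h
  exact UniqueFactorizationMonoid.irreducible_iff_prime.mp hirr

/-- The cubic cone `k[X₀,X₁,X₂] ⧸ (f)` is a domain. [folklore] -/
theorem isDomain_quotient_f :
    IsDomain (MvPolynomial (Fin 3) k ⧸ Ideal.span ({X 0 ^ 2 * X 1 + X 1 ^ 2 * X 2 + X 2 ^ 2 * X 0} :
      Set (MvPolynomial (Fin 3) k))) :=
  (Ideal.Quotient.isDomain_iff_prime _).mpr ((Ideal.span_singleton_prime (prime_f k).ne_zero).mpr (prime_f k))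

end Prime

/-! ## §2 A field `K` with an injective `ι : k[X] ⧸ (f) → K`: `hker` and the graded embedding `θ̄ : A ↪ K[T]` -/

section Model

variable {k K : Type} [Field k] [Field K] [Algebra k K]

/-- A form `F` of degree `d` evaluates at `(C(x₀)T, C(x₁)T, C(x₂)T)` to `C(F(x))·Tᵈ`. [folklore] -/
theorem aeval_C_mul_X_of_isHomogeneous (g : Fin 3 → K) {F : MvPolynomial (Fin 3) k} {d : ℕ} (hF : F.IsHomogeneous d) :
    MvPolynomial.aeval (fun i => Polynomial.C (g i) * Polynomial.X) F =
      Polynomial.C (MvPolynomial.aeval g F) * Polynomial.X ^ d := by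
  classical
  have key : ∀ m ∈ F.support, MvPolynomial.aeval (fun i => Polynomial.C (g i) * Polynomial.X) (monomial m (coeff m F)) =
      Polynomial.C (MvPolynomial.aeval g (monomial m (coeff m F))) * Polynomial.X ^ d := by
    intro m hm
    have hdeg : (∑ i ∈ m.support, m i) = d := (hF.degree_eq_sum_deg_support hm).symm
    rw [aeval_monomial, aeval_monomial, Polynomial.algebraMap_apply, map_mul, map_finsuppProd]
    simp only [mul_pow, ← map_pow]
    rw [Finsupp.prod_mul]
    have hX : (m.prod fun _ b => (Polynomial.X : Polynomial K) ^ b) = Polynomial.X ^ d := by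
      rw [Finsupp.prod, Finset.prod_pow_eq_pow_sum, hdeg]
    rw [hX]
    ring
  conv_lhs => rw [F.as_sum, map_sum]
  conv_rhs => rw [F.as_sum, map_sum, map_sum, Finset.sum_mul]
  exact Finset.sum_congr rfl key

variable (ι : (MvPolynomial (Fin 3) k ⧸ Ideal.span ({X 0 ^ 2 * X 1 + X 1 ^ 2 * X 2 + X 2 ^ 2 * X 0} :
    Set (MvPolynomial (Fin 3) k))) →ₐ[k] K)

/-- `aeval (x,y,z) = ι ∘ mk` for `x, y, z` the images of `X₀, X₁, X₂` under `ι ∘ mk`. [folklore] -/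
theorem aeval_eq_comp_mk :
    MvPolynomial.aeval (R := k) (![ι (Ideal.Quotient.mk _ (X 0)), ι (Ideal.Quotient.mk _ (X 1)),
        ι (Ideal.Quotient.mk _ (X 2))] : Fin 3 → K) =
      ι.comp (Ideal.Quotient.mkₐ k (Ideal.span ({X 0 ^ 2 * X 1 + X 1 ^ 2 * X 2 + X 2 ^ 2 * X 0} :
        Set (MvPolynomial (Fin 3) k)))) := by
  refine MvPolynomial.algHom_ext fun i => ?_
  rw [MvPolynomial.aeval_X, AlgHom.comp_apply, Ideal.Quotient.mkₐ_eq_mk]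
  fin_cases i <;> rfl

variable (hι : Function.Injective ι)
include hι

/-- **`hker` in the model**: for an injective `ι`, the kernel of `Xᵢ ↦ ι(X̄ᵢ)` is exactly `(f)`. [folklore] -/
theorem ker_aeval_eq_span_f :
    RingHom.ker (MvPolynomial.aeval (R := k) (![ι (Ideal.Quotient.mk _ (X 0)), ι (Ideal.Quotient.mk _ (X 1)),
        ι (Ideal.Quotient.mk _ (X 2))] : Fin 3 → K)).toRingHom =
      Ideal.span {X 0 ^ 2 * X 1 + X 1 ^ 2 * X 2 + X 2 ^ 2 * X 0} := by
  ext p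
  rw [RingHom.mem_ker, AlgHom.toRingHom_eq_coe, RingHom.coe_coe, aeval_eq_comp_mk, AlgHom.comp_apply,
    Ideal.Quotient.mkₐ_eq_mk, map_eq_zero_iff _ hι, Ideal.Quotient.eq_zero_iff_mem]

/-- `θ : k[X] → K[T]`, `Xᵢ ↦ C(xᵢ)·T`, kills `f` (a form vanishing at `(x,y,z)`). [folklore] -/
theorem aeval_C_mul_X_f :
    MvPolynomial.aeval (fun i => Polynomial.C ((![ι (Ideal.Quotient.mk _ (X 0)), ι (Ideal.Quotient.mk _ (X 1)),
        ι (Ideal.Quotient.mk _ (X 2))] : Fin 3 → K) i) * Polynomial.X)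
      (X 0 ^ 2 * X 1 + X 1 ^ 2 * X 2 + X 2 ^ 2 * X 0 : MvPolynomial (Fin 3) k) = 0 := by
  have hf : (X 0 ^ 2 * X 1 + X 1 ^ 2 * X 2 + X 2 ^ 2 * X 0 : MvPolynomial (Fin 3) k).IsHomogeneous 3 := by
    have h1 := ((isHomogeneous_X_pow (R := k) (0 : Fin 3) 2).mul (isHomogeneous_X k 1))
    have h2 := ((isHomogeneous_X_pow (R := k) (1 : Fin 3) 2).mul (isHomogeneous_X k 2))
    have h3 := ((isHomogeneous_X_pow (R := k) (2 : Fin 3) 2).mul (isHomogeneous_X k 0))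
    exact (h1.add h2).add h3
  rw [aeval_C_mul_X_of_isHomogeneous _ hf]
  have h0 : MvPolynomial.aeval (R := k) (![ι (Ideal.Quotient.mk _ (X 0)), ι (Ideal.Quotient.mk _ (X 1)),
      ι (Ideal.Quotient.mk _ (X 2))] : Fin 3 → K) (X 0 ^ 2 * X 1 + X 1 ^ 2 * X 2 + X 2 ^ 2 * X 0) = 0 := by
    have hmem : (X 0 ^ 2 * X 1 + X 1 ^ 2 * X 2 + X 2 ^ 2 * X 0 : MvPolynomial (Fin 3) k) ∈
        RingHom.ker (MvPolynomial.aeval (R := k) (![ι (Ideal.Quotient.mk _ (X 0)), ι (Ideal.Quotient.mk _ (X 1)),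
          ι (Ideal.Quotient.mk _ (X 2))] : Fin 3 → K)).toRingHom := by
      rw [ker_aeval_eq_span_f ι hι]; exact Ideal.mem_span_singleton_self _
    exact hmem
  rw [h0, map_zero, zero_mul]

/-- **The graded embedding is injective on `A`**: if `θ(F) = 0` then `F ∈ (f)` — the coefficient of `Tᵈ` in `θ(F)` is the
value at `(x,y,z)` of the degree-`d` component of `F`, so every component lies in `ker = (f)`. [folklore] -/
theorem mem_span_f_of_aeval_C_mul_X_eq_zero {F : MvPolynomial (Fin 3) k}
    (hF : MvPolynomial.aeval (fun i => Polynomial.C ((![ι (Ideal.Quotient.mk _ (X 0)), ι (Ideal.Quotient.mk _ (X 1)),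
        ι (Ideal.Quotient.mk _ (X 2))] : Fin 3 → K) i) * Polynomial.X) F = 0) :
    F ∈ Ideal.span ({X 0 ^ 2 * X 1 + X 1 ^ 2 * X 2 + X 2 ^ 2 * X 0} : Set (MvPolynomial (Fin 3) k)) := by
  set g : Fin 3 → K := ![ι (Ideal.Quotient.mk _ (X 0)), ι (Ideal.Quotient.mk _ (X 1)), ι (Ideal.Quotient.mk _ (X 2))]
    with hg
  have hsum : MvPolynomial.aeval (fun i => Polynomial.C (g i) * Polynomial.X) F = ∑ d ∈ Finset.range (F.totalDegree + 1),
      Polynomial.C (MvPolynomial.aeval g (homogeneousComponent d F)) * Polynomial.X ^ d := by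
    conv_lhs => rw [← sum_homogeneousComponent F, map_sum]
    exact Finset.sum_congr rfl fun d _ => aeval_C_mul_X_of_isHomogeneous g (homogeneousComponent_isHomogeneous d F)
  have hcomp : ∀ d, MvPolynomial.aeval g (homogeneousComponent d F) = 0 := by
    intro d
    by_cases hd : d < F.totalDegree + 1
    · have hcoeff := congrArg (fun q : Polynomial K => q.coeff d) hF
      simp only [Polynomial.coeff_zero] at hcoeff
      rw [hsum, Polynomial.finsetSum_coeff, Finset.sum_eq_single d
        (fun e _ hed => by rw [Polynomial.coeff_C_mul_X_pow, if_neg (Ne.symm hed)])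
        (fun h => absurd (Finset.mem_range.mpr hd) h), Polynomial.coeff_C_mul_X_pow, if_pos rfl] at hcoeff
      exact hcoeff
    · rw [homogeneousComponent_eq_zero _ _ (by omega), map_zero]
  rw [← sum_homogeneousComponent F]
  refine Ideal.sum_mem _ fun d _ => ?_
  have hmem : homogeneousComponent d F ∈ RingHom.ker (MvPolynomial.aeval (R := k) g).toRingHom := hcomp d
  rwa [hg, ker_aeval_eq_span_f ι hι] at hmem

end Model

/-! ## §3 `K = Frac A`: the weight valuation, `hk`, `hx`, `hW`, and `Frac k[x,y,z] = K` -/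

section Valuation

variable {k K : Type} [Field k] [Field K] [Algebra k K]
  [Algebra (MvPolynomial (Fin 3) k ⧸ Ideal.span ({X 0 ^ 2 * X 1 + X 1 ^ 2 * X 2 + X 2 ^ 2 * X 0} :
    Set (MvPolynomial (Fin 3) k))) K]
  [IsScalarTower k (MvPolynomial (Fin 3) k ⧸ Ideal.span ({X 0 ^ 2 * X 1 + X 1 ^ 2 * X 2 + X 2 ^ 2 * X 0} :
    Set (MvPolynomial (Fin 3) k))) K]
  [IsFractionRing (MvPolynomial (Fin 3) k ⧸ Ideal.span ({X 0 ^ 2 * X 1 + X 1 ^ 2 * X 2 + X 2 ^ 2 * X 0} :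
    Set (MvPolynomial (Fin 3) k))) K]

/-- **THE WEIGHT VALUATION EXISTS (OURS · W4.4 (R-QH) non-vacuity).** `A = k[X] ⧸ (f)` the cubic cone, `K = Frac A`,
`x, y, z` the images of `X₀, X₁, X₂`: there is a valuation ring `O ⊆ K` containing `k`, centred at the vertex
(`O.valuation x < 1`), with the WEIGHT property `O.valuation (F(x,y,z)) = (O.valuation x)ᵈ` for every form `F` of degree `d`
with `F(x,y,z) ≠ 0`. Construction: the graded embedding `A ↪ K[T]`, `Xᵢ ↦ C(xᵢ)·T` (§2), extended to `φ : K → K(T)`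
(`IsFractionRing.lift`), and `O :=` the valuation ring of `v_T ∘ φ`, `v_T` the `T`-adic valuation (`Polynomial.idealX`):
a form of degree `d` goes to `C(F(x,y,z))·Tᵈ`, of `T`-adic value `exp(−d)`. [OURS · W4.4 kill test] -/
theorem exists_weightValuation :
    ∃ O : ValuationSubring K, (∀ c : k, algebraMap k K c ∈ O) ∧
      O.valuation (algebraMap _ K (Ideal.Quotient.mk (Ideal.span ({X 0 ^ 2 * X 1 + X 1 ^ 2 * X 2 + X 2 ^ 2 * X 0} : Set (MvPolynomial (Fin 3) k))) (X 0))) < 1 ∧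
      ∀ (d : ℕ) (F : MvPolynomial (Fin 3) k), F.IsHomogeneous d →
        MvPolynomial.aeval (![algebraMap _ K (Ideal.Quotient.mk (Ideal.span ({X 0 ^ 2 * X 1 + X 1 ^ 2 * X 2 + X 2 ^ 2 * X 0} : Set (MvPolynomial (Fin 3) k))) (X 0)), algebraMap _ K (Ideal.Quotient.mk (Ideal.span ({X 0 ^ 2 * X 1 + X 1 ^ 2 * X 2 + X 2 ^ 2 * X 0} : Set (MvPolynomial (Fin 3) k))) (X 1)),
          algebraMap _ K (Ideal.Quotient.mk (Ideal.span ({X 0 ^ 2 * X 1 + X 1 ^ 2 * X 2 + X 2 ^ 2 * X 0} : Set (MvPolynomial (Fin 3) k))) (X 2))] : Fin 3 → K) F ≠ 0 →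
        O.valuation (MvPolynomial.aeval (![algebraMap _ K (Ideal.Quotient.mk (Ideal.span ({X 0 ^ 2 * X 1 + X 1 ^ 2 * X 2 + X 2 ^ 2 * X 0} : Set (MvPolynomial (Fin 3) k))) (X 0)),
          algebraMap _ K (Ideal.Quotient.mk (Ideal.span ({X 0 ^ 2 * X 1 + X 1 ^ 2 * X 2 + X 2 ^ 2 * X 0} : Set (MvPolynomial (Fin 3) k))) (X 1)),
          algebraMap _ K (Ideal.Quotient.mk (Ideal.span ({X 0 ^ 2 * X 1 + X 1 ^ 2 * X 2 + X 2 ^ 2 * X 0} : Set (MvPolynomial (Fin 3) k))) (X 2))] : Fin 3 → K) F) =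
          O.valuation (algebraMap _ K (Ideal.Quotient.mk (Ideal.span ({X 0 ^ 2 * X 1 + X 1 ^ 2 * X 2 + X 2 ^ 2 * X 0} : Set (MvPolynomial (Fin 3) k))) (X 0))) ^ d := by
  set A := MvPolynomial (Fin 3) k ⧸ Ideal.span ({X 0 ^ 2 * X 1 + X 1 ^ 2 * X 2 + X 2 ^ 2 * X 0} :
    Set (MvPolynomial (Fin 3) k)) with hA
  let ιA : A →ₐ[k] K := IsScalarTower.toAlgHom k A K
  have hι : Function.Injective ιA := IsFractionRing.injective A K
  set g : Fin 3 → K := ![algebraMap A K (Ideal.Quotient.mk _ (X 0)), algebraMap A K (Ideal.Quotient.mk _ (X 1)),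
    algebraMap A K (Ideal.Quotient.mk _ (X 2))] with hg
  have hgι : g = ![ιA (Ideal.Quotient.mk _ (X 0)), ιA (Ideal.Quotient.mk _ (X 1)), ιA (Ideal.Quotient.mk _ (X 2))] := rfl
  have haeval : ∀ F : MvPolynomial (Fin 3) k, MvPolynomial.aeval g F = algebraMap A K (Ideal.Quotient.mk _ F) := by
    intro F
    rw [hgι, aeval_eq_comp_mk ιA]
    rfl
  let θ : MvPolynomial (Fin 3) k →ₐ[k] Polynomial K :=
    MvPolynomial.aeval (fun i => Polynomial.C (g i) * Polynomial.X)
  have hθf : ∀ a ∈ Ideal.span ({X 0 ^ 2 * X 1 + X 1 ^ 2 * X 2 + X 2 ^ 2 * X 0} : Set (MvPolynomial (Fin 3) k)),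
      θ.toRingHom a = 0 := by
    intro a ha
    obtain ⟨q, rfl⟩ := Ideal.mem_span_singleton'.mp ha
    rw [AlgHom.toRingHom_eq_coe, RingHom.coe_coe, map_mul]
    have h0 : θ (X 0 ^ 2 * X 1 + X 1 ^ 2 * X 2 + X 2 ^ 2 * X 0) = 0 := aeval_C_mul_X_f ιA hι
    rw [h0, mul_zero]
  let θbar : A →+* Polynomial K := Ideal.Quotient.lift _ θ.toRingHom hθf
  have hθbar : ∀ F : MvPolynomial (Fin 3) k, θbar (Ideal.Quotient.mk _ F) = θ F := fun F =>
    Ideal.Quotient.lift_mk _ _ _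
  have hθbar_inj : Function.Injective θbar := by
    rw [injective_iff_map_eq_zero]
    intro a ha
    obtain ⟨F, rfl⟩ := Ideal.Quotient.mk_surjective a
    rw [hθbar] at ha
    exact Ideal.Quotient.eq_zero_iff_mem.mpr (mem_span_f_of_aeval_C_mul_X_eq_zero ιA hι (hgι ▸ ha))
  let θ' : A →+* RatFunc K := (algebraMap (Polynomial K) (RatFunc K)).comp θbar
  have hθ'_inj : Function.Injective θ' := (IsFractionRing.injective (Polynomial K) (RatFunc K)).comp hθbar_inj
  let φ : K →+* RatFunc K := IsFractionRing.lift hθ'_inj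
  have hφ : ∀ F : MvPolynomial (Fin 3) k,
      φ (MvPolynomial.aeval g F) = algebraMap (Polynomial K) (RatFunc K) (θ F) := by
    intro F
    rw [haeval, IsFractionRing.lift_algebraMap hθ'_inj, RingHom.comp_apply, hθbar]
  let w : Valuation K (WithZero (Multiplicative ℤ)) := ((Polynomial.idealX K).valuation (RatFunc K)).comap φ
  have hw : ∀ F : MvPolynomial (Fin 3) k, w (MvPolynomial.aeval g F) = (Polynomial.idealX K).intValuation (θ F) := by
    intro F
    rw [Valuation.comap_apply, hφ, IsDedekindDomain.HeightOneSpectrum.valuation_of_algebraMap]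
  have hC : ∀ c : K, c ≠ 0 → (Polynomial.idealX K).intValuation (Polynomial.C c) = 1 := by
    intro c hc
    rw [IsDedekindDomain.HeightOneSpectrum.intValuation_eq_one_iff_mem_primeCompl, Ideal.mem_primeCompl_iff,
      Polynomial.idealX_span, Ideal.mem_span_singleton, Polynomial.X_dvd_iff, Polynomial.coeff_C_zero]
    exact hc
  have hT : (Polynomial.idealX K).intValuation Polynomial.X < 1 := by
    rw [IsDedekindDomain.HeightOneSpectrum.intValuation_lt_one_iff_mem, Polynomial.idealX_span]
    exact Ideal.mem_span_singleton_self _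
  have hform : ∀ (d : ℕ) (F : MvPolynomial (Fin 3) k), F.IsHomogeneous d → MvPolynomial.aeval g F ≠ 0 →
      w (MvPolynomial.aeval g F) = (Polynomial.idealX K).intValuation Polynomial.X ^ d := by
    intro d F hF hF0
    rw [hw, show θ F = Polynomial.C (MvPolynomial.aeval g F) * Polynomial.X ^ d from
      aeval_C_mul_X_of_isHomogeneous g hF, map_mul, map_pow, hC _ hF0, one_mul]
  have hx0 : g 0 ≠ 0 := by rw [hgι]; exact coord_ne_zero (ker_aeval_eq_span_f ιA hι) 0
  have hwx : w (g 0) = (Polynomial.idealX K).intValuation Polynomial.X := by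
    have h := hform 1 (X 0) (isHomogeneous_X k 0) (by rw [MvPolynomial.aeval_X]; exact hx0)
    rwa [MvPolynomial.aeval_X, pow_one] at h
  have hequiv := Valuation.isEquiv_valuation_valuationSubring w
  refine ⟨w.valuationSubring, fun c => ?_, ?_, fun d F hF hF0 => ?_⟩
  · -- `k ⊆ O`
    rw [Valuation.mem_valuationSubring_iff, show algebraMap k K c = MvPolynomial.aeval g (C c) from
      (MvPolynomial.aeval_C _ _).symm, hw]
    exact IsDedekindDomain.HeightOneSpectrum.intValuation_le_one _ _
  · -- centred at the vertex
    change w.valuationSubring.valuation (g 0) < 1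
    rw [← hequiv.lt_one_iff_lt_one, hwx]
    exact hT
  · -- the weight property
    change w.valuationSubring.valuation (MvPolynomial.aeval g F) = w.valuationSubring.valuation (g 0) ^ d
    rw [← map_pow, ← hequiv.eq_iff, hform d F hF hF0, map_pow, hwx]

/-- **`K = Frac A` is the fraction field of the range `k[x,y,z] ⊆ K`** (the range of `Xᵢ ↦ x, y, z` is the image of
`A`). [folklore] -/
theorem isFractionRing_range :
    IsFractionRing ↥(MvPolynomial.aeval (R := k) (![algebraMap _ K (Ideal.Quotient.mk (Ideal.span ({X 0 ^ 2 * X 1 + X 1 ^ 2 * X 2 + X 2 ^ 2 * X 0} : Set (MvPolynomial (Fin 3) k))) (X 0)),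
        algebraMap _ K (Ideal.Quotient.mk (Ideal.span ({X 0 ^ 2 * X 1 + X 1 ^ 2 * X 2 + X 2 ^ 2 * X 0} : Set (MvPolynomial (Fin 3) k))) (X 1)),
        algebraMap _ K (Ideal.Quotient.mk (Ideal.span ({X 0 ^ 2 * X 1 + X 1 ^ 2 * X 2 + X 2 ^ 2 * X 0} : Set (MvPolynomial (Fin 3) k))) (X 2))] : Fin 3 → K)).range K := by
  set A := MvPolynomial (Fin 3) k ⧸ Ideal.span ({X 0 ^ 2 * X 1 + X 1 ^ 2 * X 2 + X 2 ^ 2 * X 0} :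
    Set (MvPolynomial (Fin 3) k)) with hA
  let ιA : A →ₐ[k] K := IsScalarTower.toAlgHom k A K
  have hgι : (![algebraMap A K (Ideal.Quotient.mk _ (X 0)), algebraMap A K (Ideal.Quotient.mk _ (X 1)),
      algebraMap A K (Ideal.Quotient.mk _ (X 2))] : Fin 3 → K) =
      ![ιA (Ideal.Quotient.mk _ (X 0)), ιA (Ideal.Quotient.mk _ (X 1)), ιA (Ideal.Quotient.mk _ (X 2))] := rfl
  have hmem : ∀ a : A, algebraMap A K a ∈ (MvPolynomial.aeval (R := k) (![algebraMap A K (Ideal.Quotient.mk _ (X 0)),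
      algebraMap A K (Ideal.Quotient.mk _ (X 1)), algebraMap A K (Ideal.Quotient.mk _ (X 2))] : Fin 3 → K)).range := by
    intro a
    obtain ⟨F, rfl⟩ := Ideal.Quotient.mk_surjective a
    refine ⟨F, ?_⟩
    rw [hgι, aeval_eq_comp_mk ιA]
    rfl
  apply IsFractionRing.of_field
  intro z
  obtain ⟨a, b, -, rfl⟩ := IsFractionRing.div_surjective (A := A) z
  exact ⟨⟨algebraMap A K a, hmem a⟩, ⟨algebraMap A K b, hmem b⟩, rfl⟩

end Valuation

/-! ## §4 The witness, packaged, and the (E) pair inhabited -/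

/-- **NON-VACUITY WITNESS (OURS · W4.4 (R-QH)).** For EVERY field `k` there are a field `K ⊇ k`, elements `x, y, z ∈ K` and a
valuation ring `O ⊆ K` satisfying ALL hypotheses of `initialPair_cubicCone` / `exists_isRegularLocalRing_tower_cubicCone`
that concern the datum: `hker` (the kernel of `Xᵢ ↦ x, y, z` is `(f)`), `hk` (`k ⊆ O`), `hx` (`O.valuation x < 1`), the
WEIGHT property `hW`, and `IsFractionRing ↥k[x,y,z] K`. Namely `K = Frac (k[X] ⧸ (f))` (§1: `f` is prime), `x, y, z` the
classes of `X₀, X₁, X₂`, `O` the weight valuation ring of §3. [OURS · W4.4 kill test] -/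
theorem exists_cubicCone_weightValuation_witness (k : Type) [Field k] :
    ∃ (K : Type) (_ : Field K) (_ : Algebra k K) (x y z : K) (O : ValuationSubring K),
      RingHom.ker (MvPolynomial.aeval (R := k) (![x, y, z] : Fin 3 → K)).toRingHom =
          Ideal.span {X 0 ^ 2 * X 1 + X 1 ^ 2 * X 2 + X 2 ^ 2 * X 0} ∧
        (∀ c : k, algebraMap k K c ∈ O) ∧ O.valuation x < 1 ∧
        (∀ (d : ℕ) (F : MvPolynomial (Fin 3) k), F.IsHomogeneous d → MvPolynomial.aeval ![x, y, z] F ≠ 0 →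
          O.valuation (MvPolynomial.aeval ![x, y, z] F) = O.valuation x ^ d) ∧
        IsFractionRing ↥(MvPolynomial.aeval (R := k) (![x, y, z] : Fin 3 → K)).range K := by
  letI := isDomain_quotient_f k
  set A := MvPolynomial (Fin 3) k ⧸ Ideal.span ({X 0 ^ 2 * X 1 + X 1 ^ 2 * X 2 + X 2 ^ 2 * X 0} :
    Set (MvPolynomial (Fin 3) k)) with hA
  obtain ⟨O, hk, hx, hW⟩ := exists_weightValuation (k := k) (K := FractionRing A)
  refine ⟨FractionRing A, inferInstance, inferInstance, algebraMap A (FractionRing A) (Ideal.Quotient.mk (Ideal.span ({X 0 ^ 2 * X 1 + X 1 ^ 2 * X 2 + X 2 ^ 2 * X 0} : Set (MvPolynomial (Fin 3) k))) (X 0)),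
    algebraMap A (FractionRing A) (Ideal.Quotient.mk (Ideal.span ({X 0 ^ 2 * X 1 + X 1 ^ 2 * X 2 + X 2 ^ 2 * X 0} : Set (MvPolynomial (Fin 3) k))) (X 1)), algebraMap A (FractionRing A) (Ideal.Quotient.mk (Ideal.span ({X 0 ^ 2 * X 1 + X 1 ^ 2 * X 2 + X 2 ^ 2 * X 0} : Set (MvPolynomial (Fin 3) k))) (X 2)), O, ?_, hk, hx, hW, ?_⟩
  · exact ker_aeval_eq_span_f (IsScalarTower.toAlgHom k A (FractionRing A)) (IsFractionRing.injective A _)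
  · exact isFractionRing_range

/-- **THE (E) PAIR OF THE CUBIC CONE IS INHABITED (OURS · W4.4 (R-QH)).** Part 2's `initialPair_cubicCone` applied to the
witness: over every field `k` there is a datum `(K, x, y, z, O)` — the cubic cone with its weight valuation — at which
`x² + 2yz, y² + 2zx` form an (E) initial pair at stage `0` of the `ca`-tower (the residue stub's conclusion, `m' = 0`).
[OURS · W4.4 kill test] -/
theorem initialPair_cubicCone_inhabited (k : Type) [Field k] :
    ∃ (K : Type) (_ : Field K) (_ : Algebra k K) (x y z : K) (O : ValuationSubring K),
      (x ^ 2 + 2 * y * z) ∈ NoZeno.Birth.ca (NoZeno.Birth.tower O (MvPolynomial.aeval (R := k) (![x, y, z] : Fin 3 → K)).range 0) ∧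
      (y ^ 2 + 2 * z * x) ∈ NoZeno.Birth.ca (NoZeno.Birth.tower O (MvPolynomial.aeval (R := k) (![x, y, z] : Fin 3 → K)).range 0) ∧
      (x ^ 2 + 2 * y * z) ≠ 0 ∧
      (∀ c ∈ NoZeno.Birth.ca (NoZeno.Birth.tower O (MvPolynomial.aeval (R := k) (![x, y, z] : Fin 3 → K)).range 0),
        c * (x ^ 2 + 2 * y * z)⁻¹ ∈ O) ∧
      ∀ P : Polynomial k, P ≠ 0 →
        ¬ O.valuation (Polynomial.aeval ((y ^ 2 + 2 * z * x) * (x ^ 2 + 2 * y * z)⁻¹) P) < 1 := by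
  obtain ⟨K, _, _, x, y, z, O, hker, hk, hx, hW, -⟩ := exists_cubicCone_weightValuation_witness k
  exact ⟨K, inferInstance, inferInstance, x, y, z, O, initialPair_cubicCone hker hW hx hk⟩

end Summit.ResolutionOfSingularities.ResolutionOfSingularities.Theorems.SurfaceTermination.CubicCone

end
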